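import Summits.NavierStokesRegularity.FluidComputer.RotorKnobPulseDouse
import HarnessLib

/-!
# The seed–rotor scale knob under the PULSE hypothesis, part 3: (toke) and (beable) from `T` on

Companion of `RotorKnobPulse{Fire,Douse}.lean` (cell `pub-fluidc`, blueprint seat bp1, gen 24; ONE
text split by the 400-line rule; namespace `Summit.NavierStokesRegularity.FluidComputer.RotorKnob`).
HONEST FRAMING (verbatim): low prior, high value-of-information experiment on Tao's machine
paradigm; NOT a claim that NS blows up. Setting of parts 1–2 (exact trajectory of
`rotorCircuit K M ε ρ` from `delayInit`, critical time `τ`, onset delay `δ`, horizon `T ≤ 2`,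
PULSE HYPOTHESIS (hρT) `64·M·ρ⁴·e^{4M(T-τ)} ≤ ε²K²⁰`); nothing is proved about Navier–Stokes.

THIS FILE (§Decay of the printed bootstrap, horizon `T`, plus the free aftermath): `KVe_small_on`;
`Es_decay_on` — **(toke)** in the time-resolved form `E_*(t) ≤ e^{(K/10)(t'-t)} + 70K⁻⁹⁰` on
`[t', T]`, `t' = τ + δ + 1/K`; `ad_small_on` — `a² + d² ≤ 142K⁻²⁰` on `[t' + L, T]` for any drain
time `L ≥ 0` with (N4') `2e^{-KL/10} ≤ K⁻²⁰` (part 4 takes `L = 300 log K/K`); `sum_sq_after` —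
`a² + b² + c² + d² ≤ 143K⁻²⁰` for ALL `t ≥ t' + L` once `t' + L ≤ T`: on `[t' + L, T]` by the above,
and for `t ≥ T` because `ã` is non-decreasing and `a² + b² + c² + d² = 1 - ã²` ((energy-con)) —
this is where the horizon `2` of gen 22's `RotorKnob.late_sum_sq` becomes unnecessary.
(beable)/(able) themselves are `RotorKnob.beable_of_sum_sq` / `RotorKnob.able_window`
(`RotorKnobTransition.lean`), reused by name in part 4. Port of `AmplitudeKnobBeable.lean` (gen 20,
the diagonal `ρ = ε`) along the seed–rotor scale.
[cite: Tao2016AveragedNS, §5.5 Thm 5.3 proof: (toke), (beable)]. No named facts; 0 sorry.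
-/

noncomputable section

namespace Summit.NavierStokesRegularity.FluidComputer.RotorKnob

open Set Real Filter
open _root_.Topology
open Literature.Analysis.FluidPDE.Tao2016AveragedNS
open Literature.Analysis.FluidPDE.Tao2016AveragedNS.Thm53 (antitoneOn_intFactor decay_alg)

section PulseBeable

variable {K M ε ρ τ δ T L : ℝ} {X : ℝ → Fin 5 → ℝ}


/-! ## (toke): decay of the equipartition energy on `[t', T]` -/

/-- On `I = [τ + δ, T]`: `|½K·V·ã| ≤ ½K⁻⁹⁹` (`V = adρ²/c`, `ρ²/c ≤ K⁻¹⁰⁰`).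
[cite: Tao2016AveragedNS, §5.5 (proof of (beable))] -/
theorem KVe_small_on (hX : ∀ t, HasDerivAt X (rotorCircuit K M ε ρ (X t)) t) (h0 : X 0 = delayInit)
    (hε : 0 < ε) (hρ : 0 < ρ) (hρε : ρ ^ 2 ≤ ε) (hM0 : 0 < M) (hK : 16 ≤ K)
    (hεK : ε ^ 2 ≤ 1 / (6 * K ^ 20)) (hMρ : M * ρ ^ 4 ≤ ε ^ 2) (hKM : exp (-M) ≤ 1 / K ^ 10)
    (hδ : 0 ≤ δ) (hon : K ^ 110 ≤ exp (M * δ / 8))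
    (hτ1 : 1 ≤ τ) (hτT : τ ≤ T) (hT2 : T ≤ 2)
    (hρT : 64 * M * ρ ^ 4 * exp (4 * M * (T - τ)) ≤ ε ^ 2 * K ^ 20)
    (hcτ : ∀ t, 0 ≤ t → t ≤ τ → X t 2 ≤ ρ ^ 2 / K ^ 10) (hcτeq : X τ 2 = ρ ^ 2 / K ^ 10)
    {s : ℝ} (hs : s ∈ Icc (τ + δ) T) :
    |K / 2 * (X s 0 * X s 3 * (ρ ^ 2 * (X s 2)⁻¹) * X s 4)| ≤ 1 / 2 / K ^ 99 := by
  have hK0 : 0 < K := by linarith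
  have hcl : K ^ 100 * ρ ^ 2 ≤ X s 2 :=
    c_large_on hX h0 hε hρ hρε hM0 hK hεK hMρ hKM hδ hon hτ1 hτT hT2 hρT hcτ hcτeq hs
  have hcpos : 0 < X s 2 := lt_of_lt_of_le (by positivity) hcl
  have hq0 : 0 ≤ ρ ^ 2 * (X s 2)⁻¹ := by positivity
  have hq : ρ ^ 2 * (X s 2)⁻¹ ≤ 1 / K ^ 100 := by
    rw [← div_eq_mul_inv, div_le_div_iff₀ hcpos (by positivity), one_mul]; linarith
  rw [abs_mul, abs_of_pos (by positivity : 0 < K / 2), abs_mul, abs_mul, abs_mul,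
    abs_of_nonneg hq0]
  calc K / 2 * (|X s 0| * |X s 3| * (ρ ^ 2 * (X s 2)⁻¹) * |X s 4|)
      ≤ K / 2 * (1 * 1 * (1 / K ^ 100) * 1) := by
        refine mul_le_mul_of_nonneg_left ?_ (by positivity)
        exact mul_le_mul (mul_le_mul (mul_le_mul (traj_abs_le_one hX h0 s 0)
          (traj_abs_le_one hX h0 s 3) (abs_nonneg _) zero_le_one) hq hq0 (by norm_num))
          (traj_abs_le_one hX h0 s 4) (abs_nonneg _) (by positivity)
    _ = 1 / 2 / K ^ 99 := by field_simp

/-- **(toke), time-resolved, on the horizon `T`**: for `t ∈ [t', T]`, `t' = τ + δ + 1/K`,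
`E_*(t) ≤ e^{-Kã(t')(t-t')} + 7K⁻⁸⁹/(Kã(t')) ≤ e^{(K/10)(t'-t)} + 70K⁻⁹⁰` (Grönwall from `t'`,
`ã(t') ≥ 1/10` by `e_tenth_on`). [cite: Tao2016AveragedNS, §5.5 (toke)] -/
theorem Es_decay_on (hX : ∀ t, HasDerivAt X (rotorCircuit K M ε ρ (X t)) t) (h0 : X 0 = delayInit)
    (hε : 0 < ε) (hε1 : ε ≤ 1) (hρ : 0 < ρ) (hρε : ρ ^ 2 ≤ ε) (hM0 : 0 < M) (hMK : M ≤ K ^ 10)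
    (hK : 16 ≤ K)
    (hεK : ε ^ 2 ≤ 1 / (6 * K ^ 20)) (hMρ : M * ρ ^ 4 ≤ ε ^ 2) (hε100 : ε ≤ 1 / K ^ 100)
    (hKM : exp (-M) ≤ 1 / K ^ 10)
    (hδ : 0 ≤ δ) (hon : K ^ 110 ≤ exp (M * δ / 8))
    (hτ1 : 1 ≤ τ) (hfit : τ + δ + K⁻¹ ≤ T) (hT2 : T ≤ 2)
    (hρT : 64 * M * ρ ^ 4 * exp (4 * M * (T - τ)) ≤ ε ^ 2 * K ^ 20)
    (hcτ : ∀ t, 0 ≤ t → t ≤ τ → X t 2 ≤ ρ ^ 2 / K ^ 10) (hcτeq : X τ 2 = ρ ^ 2 / K ^ 10)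
    {t : ℝ} (ht : t ∈ Icc (τ + δ + K⁻¹) T) :
    (1 - X t 4 * X t 4) / 2 - K / 2 * (X t 0 * X t 3 * (ρ ^ 2 * (X t 2)⁻¹) * X t 4)
      ≤ exp (K / 10 * ((τ + δ + K⁻¹) - t)) + 70 / K ^ 90 := by
  have hK0 : 0 < K := by linarith
  have hK1 : 1 ≤ K := by linarith
  have hu0' : 0 < K⁻¹ := inv_pos.2 hK0
  have hτT : τ ≤ T := by linarith
  have he₀ : 1 / 10 ≤ X (τ + δ + K⁻¹) 4 :=
    e_tenth_on hX h0 hε hε1 hρ hρε hM0 hMK hK hεK hMρ hKM hδ hon hτ1 hfit hT2 hρT hcτ hcτeq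
  have he₀pos : 0 < X (τ + δ + K⁻¹) 4 := lt_of_lt_of_le (by norm_num) he₀
  have hKe : 0 < K * X (τ + δ + K⁻¹) 4 := mul_pos hK0 he₀pos
  have ht't : τ + δ + K⁻¹ ≤ t := ht.1
  have hI : ∀ s ∈ Icc (τ + δ + K⁻¹) T, s ∈ Icc (τ + δ) T := fun s hs =>
    ⟨by linarith [hs.1], hs.2⟩
  have hC0 : 0 ≤ 7 / K ^ 89 / (K * X (τ + δ + K⁻¹) 4) := by positivity
  -- Grönwall in integrating-factor form
  have hanti := antitoneOn_intFactor (s := Icc (τ + δ + K⁻¹) T)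
    (f := fun s => (1 - X s 4 * X s 4) / 2 - K / 2 * (X s 0 * X s 3 * (ρ ^ 2 * (X s 2)⁻¹) * X s 4))
    (g := fun _ => -(K * X (τ + δ + K⁻¹) 4)) (G := fun s => -(K * X (τ + δ + K⁻¹) 4 * s))
    (φ := fun s => 7 / K ^ 89 * exp (K * X (τ + δ + K⁻¹) 4 * s))
    (Φ := fun s => 7 / K ^ 89 / (K * X (τ + δ + K⁻¹) 4) * exp (K * X (τ + δ + K⁻¹) 4 * s))
    (convex_Icc _ T)
    (fun s hs => by
      have hsI := hI s hs
      have hcl : K ^ 100 * ρ ^ 2 ≤ X s 2 :=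
        c_large_on hX h0 hε hρ hρε hM0 hK hεK hMρ hKM hδ hon hτ1 hτT hT2 hρT hcτ hcτeq hsI
      have hcne : X s 2 ≠ 0 := (lt_of_lt_of_le (by positivity) hcl).ne'
      exact hasDerivAt_Es hX hε.ne' hρ.ne' hcne)
    (fun s _ => ((hasDerivAt_id s).const_mul (K * X (τ + δ + K⁻¹) 4)).neg.congr_deriv (by simp))
    (fun s _ => by
      have hne : K * X (τ + δ + K⁻¹) 4 ≠ 0 := hKe.ne'
      have := (((hasDerivAt_id s).const_mul (K * X (τ + δ + K⁻¹) 4)).exp).const_mul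
        (7 / K ^ 89 / (K * X (τ + δ + K⁻¹) 4))
      refine this.congr_deriv ?_
      simp only [mul_one, id_eq]
      generalize X (τ + δ + K⁻¹) 4 = e₀ at hne ⊢
      have hne' : e₀ ≠ 0 := right_ne_zero_of_mul hne
      field_simp)
    (fun s hs => by
      have hdis :=
        Es_dissipation_on hX h0 hε hε1 hρ hρε hM0 hMK hK hεK hMρ hε100 hKM hδ hon hτ1 hfit hT2
        hρT hcτ hcτeq hs
      have hE : exp (-(-(K * X (τ + δ + K⁻¹) 4 * s))) = exp (K * X (τ + δ + K⁻¹) 4 * s) := by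
        rw [neg_neg]
      rw [hE]
      have h2 := mul_le_mul_of_nonneg_right hdis (exp_pos (K * X (τ + δ + K⁻¹) 4 * s)).le
      linarith)
  have ht'mem : τ + δ + K⁻¹ ∈ Icc (τ + δ + K⁻¹) T := ⟨le_rfl, hfit⟩
  have htmem : t ∈ Icc (τ + δ + K⁻¹) T := ⟨ht't, ht.2⟩
  have hA := hanti ht'mem htmem ht't
  simp only [neg_neg] at hA
  have hsplit : exp (K * X (τ + δ + K⁻¹) 4 * (τ + δ + K⁻¹))
      = exp (K * X (τ + δ + K⁻¹) 4 * t)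
        * exp (K * X (τ + δ + K⁻¹) 4 * ((τ + δ + K⁻¹) - t)) := by
    rw [← exp_add]; congr 1; ring
  rw [hsplit] at hA
  -- `E_*(t') ≤ 1`
  have hEs1 : (1 - X (τ + δ + K⁻¹) 4 * X (τ + δ + K⁻¹) 4) / 2
      - K / 2 * (X (τ + δ + K⁻¹) 0 * X (τ + δ + K⁻¹) 3 * (ρ ^ 2 * (X (τ + δ + K⁻¹) 2)⁻¹)
        * X (τ + δ + K⁻¹) 4) ≤ 1 := by
    have h1 : (1 - X (τ + δ + K⁻¹) 4 * X (τ + δ + K⁻¹) 4) / 2 ≤ 1 / 2 := by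
      nlinarith [mul_self_nonneg (X (τ + δ + K⁻¹) 4)]
    have h2 := (abs_le.1 (KVe_small_on hX h0 hε hρ hρε hM0 hK hεK hMρ hKM hδ hon hτ1 hτT hT2 hρT
      hcτ hcτeq (hI _ ht'mem))).1
    have h3 : 1 / 2 / K ^ 99 ≤ 1 / 2 := by
      rw [div_le_iff₀ (by positivity)]
      have : (1 : ℝ) ≤ K ^ 99 := one_le_pow₀ hK1
      linarith
    linarith
  have hr0 : 0 < exp (K * X (τ + δ + K⁻¹) 4 * ((τ + δ + K⁻¹) - t)) := exp_pos _
  have hEst := decay_alg (exp_pos _) hr0 hC0 hEs1 hA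
  -- `r ≤ exp((K/10)(t' - t))`
  have hrle : exp (K * X (τ + δ + K⁻¹) 4 * ((τ + δ + K⁻¹) - t))
      ≤ exp (K / 10 * ((τ + δ + K⁻¹) - t)) := by
    rw [exp_le_exp]
    have hn : (τ + δ + K⁻¹) - t ≤ 0 := by linarith
    have := mul_le_mul_of_nonpos_right (mul_le_mul_of_nonneg_left he₀ hK0.le) hn
    have e1 : K * (1 / 10) * ((τ + δ + K⁻¹) - t) = K / 10 * ((τ + δ + K⁻¹) - t) := by ring
    linarith
  have hCle : 7 / K ^ 89 / (K * X (τ + δ + K⁻¹) 4) ≤ 70 / K ^ 90 := by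
    rw [div_le_div_iff₀ hKe (by positivity)]
    calc 7 / K ^ 89 * K ^ 90 = 7 * K := by field_simp
      _ = 70 * (K * (1 / 10)) := by ring
      _ ≤ 70 * (K * X (τ + δ + K⁻¹) 4) := by
          have := mul_le_mul_of_nonneg_left he₀ hK0.le
          linarith
  linarith

/-! ## (beable) in squared form, from `t' + L` on -/

/-- **(toke) ⇒ (beable), core estimate on the horizon `T`**: on `[t' + L, T]` (`L ≥ 0` a drain time
with (N4') `2e^{-KL/10} ≤ K⁻²⁰`), `a² + d² ≤ 142K⁻²⁰` (`a² + d² = 2E_* + KVã - b² - c²`).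
[cite: Tao2016AveragedNS, §5.5 (beable)] -/
theorem ad_small_on (hX : ∀ t, HasDerivAt X (rotorCircuit K M ε ρ (X t)) t) (h0 : X 0 = delayInit)
    (hε : 0 < ε) (hε1 : ε ≤ 1) (hρ : 0 < ρ) (hρε : ρ ^ 2 ≤ ε) (hM0 : 0 < M) (hMK : M ≤ K ^ 10)
    (hK : 16 ≤ K)
    (hεK : ε ^ 2 ≤ 1 / (6 * K ^ 20)) (hMρ : M * ρ ^ 4 ≤ ε ^ 2) (hε100 : ε ≤ 1 / K ^ 100)
    (hKM : exp (-M) ≤ 1 / K ^ 10)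
    (hδ : 0 ≤ δ) (hon : K ^ 110 ≤ exp (M * δ / 8))
    (hL : 0 ≤ L) (hN4 : 2 * exp (-(K / 10 * L)) ≤ 1 / K ^ 20)
    (hτ1 : 1 ≤ τ) (hfit : τ + δ + K⁻¹ + L ≤ T) (hT2 : T ≤ 2)
    (hρT : 64 * M * ρ ^ 4 * exp (4 * M * (T - τ)) ≤ ε ^ 2 * K ^ 20)
    (hcτ : ∀ t, 0 ≤ t → t ≤ τ → X t 2 ≤ ρ ^ 2 / K ^ 10) (hcτeq : X τ 2 = ρ ^ 2 / K ^ 10)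
    {t : ℝ} (ht : t ∈ Icc (τ + δ + K⁻¹ + L) T) : X t 0 ^ 2 + X t 3 ^ 2 ≤ 142 / K ^ 20 := by
  have hK0 : 0 < K := by linarith
  have hK1 : 1 ≤ K := by linarith
  have hu0' : 0 < K⁻¹ := inv_pos.2 hK0
  have hfit' : τ + δ + K⁻¹ ≤ T := by linarith
  have hτT : τ ≤ T := by linarith
  have htI : t ∈ Icc (τ + δ) T := ⟨by linarith [ht.1], ht.2⟩
  have ht' : t ∈ Icc (τ + δ + K⁻¹) T := ⟨by linarith [ht.1], ht.2⟩
  have hEs := Es_decay_on hX h0 hε hε1 hρ hρε hM0 hMK hK hεK hMρ hε100 hKM hδ hon hτ1 hfit' hT2 hρT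
      hcτ hcτeq ht'
  have hVt := (abs_le.1 (KVe_small_on hX h0 hε hρ hρε hM0 hK hεK hMρ hKM hδ hon hτ1 hτT hT2 hρT
    hcτ hcτeq htI)).2
  have hsum := traj_sum_sq_eq_one hX h0 t
  have h99 : 1 / 2 / K ^ 99 ≤ 1 / 2 / K ^ 20 := by
    apply div_le_div_of_nonneg_left (by norm_num) (by positivity)
    exact pow_le_pow_right₀ hK1 (by norm_num)
  have h90 : 70 / K ^ 90 ≤ 70 / K ^ 20 := by
    apply div_le_div_of_nonneg_left (by norm_num) (by positivity)
    exact pow_le_pow_right₀ hK1 (by norm_num)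
  -- the drain has run for at least `L`: `e^{(K/10)(t'-t)} ≤ e^{-KL/10} ≤ K⁻²⁰/2`
  have hexpL : exp (K / 10 * ((τ + δ + K⁻¹) - t)) ≤ exp (-(K / 10 * L)) := by
    rw [exp_le_exp]
    have : (τ + δ + K⁻¹) - t ≤ -L := by linarith [ht.1]
    nlinarith
  have hexp20 : exp (K / 10 * ((τ + δ + K⁻¹) - t)) ≤ 1 / 2 / K ^ 20 := by
    refine hexpL.trans ?_
    have h := hN4
    rw [div_div, le_div_iff₀ (by positivity)]
    rw [le_div_iff₀ (by positivity)] at h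
    linarith
  -- express everything in the single atom `w = (K²⁰)⁻¹`
  have hw1 : (1 : ℝ) / 2 / K ^ 20 = 1 / 2 * (K ^ 20)⁻¹ := by ring
  have hw2 : (70 : ℝ) / K ^ 20 = 70 * (K ^ 20)⁻¹ := by ring
  have hw3 : (142 : ℝ) / K ^ 20 = 142 * (K ^ 20)⁻¹ := by ring
  rw [hw3]
  rw [hw1] at hexp20 h99
  rw [hw2] at h90
  have hee : X t 4 * X t 4 = X t 4 ^ 2 := by ring
  linarith [sq_nonneg (X t 1), sq_nonneg (X t 2)]

/-- **(beable), squared form, for ALL later times**: if `t' + L ≤ T` (`t' = τ + δ + 1/K`), then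
`a² + b² + c² + d² ≤ 143K⁻²⁰` for every `t ≥ t' + L`: on `[t' + L, T]` by `ad_small_on` and
`b, c = O(ε)`;
for `t ≥ T` because `ã` is non-decreasing and `a² + b² + c² + d² = 1 - ã²` ((energy-con)). No
hypothesis
bears on times after `T`. [cite: Tao2016AveragedNS, §5.5 (beable), (energy-con)] -/
theorem sum_sq_after (hX : ∀ t, HasDerivAt X (rotorCircuit K M ε ρ (X t)) t) (h0 : X 0 = delayInit)
    (hε : 0 < ε) (hε1 : ε ≤ 1) (hρ : 0 < ρ) (hρε : ρ ^ 2 ≤ ε) (hM0 : 0 < M) (hMK : M ≤ K ^ 10)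
    (hK : 16 ≤ K)
    (hεK : ε ^ 2 ≤ 1 / (6 * K ^ 20)) (hMρ : M * ρ ^ 4 ≤ ε ^ 2) (hε100 : ε ≤ 1 / K ^ 100)
    (hKM : exp (-M) ≤ 1 / K ^ 10)
    (hδ : 0 ≤ δ) (hon : K ^ 110 ≤ exp (M * δ / 8))
    (hL : 0 ≤ L) (hN4 : 2 * exp (-(K / 10 * L)) ≤ 1 / K ^ 20)
    (hτ1 : 1 ≤ τ) (hfit : τ + δ + K⁻¹ + L ≤ T) (hT2 : T ≤ 2)
    (hρT : 64 * M * ρ ^ 4 * exp (4 * M * (T - τ)) ≤ ε ^ 2 * K ^ 20)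
    (hcτ : ∀ t, 0 ≤ t → t ≤ τ → X t 2 ≤ ρ ^ 2 / K ^ 10) (hcτeq : X τ 2 = ρ ^ 2 / K ^ 10)
    {t : ℝ} (ht : τ + δ + K⁻¹ + L ≤ t) :
    X t 0 ^ 2 + X t 1 ^ 2 + X t 2 ^ 2 + X t 3 ^ 2 ≤ 143 / K ^ 20 := by
  have hK0 : 0 < K := by linarith
  have hK1 : 1 ≤ K := by linarith
  have hu0' : 0 < K⁻¹ := inv_pos.2 hK0
  -- `b² + c² ≤ K⁻²⁰` on `[0,2]`
  have hbc : ∀ s ∈ Icc (0 : ℝ) 2, X s 1 ^ 2 + X s 2 ^ 2 ≤ 1 / K ^ 20 := by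
    intro s hs
    obtain ⟨hb5, hc5⟩ := bc_small hX h0 hε hρ hρε hM0.le hs
    have hb2 : X s 1 ^ 2 ≤ (5 * ε) ^ 2 := by
      rw [← sq_abs]; exact pow_le_pow_left₀ (abs_nonneg _) hb5 2
    have hc2 : X s 2 ^ 2 ≤ (5 * ε) ^ 2 := by
      rw [← sq_abs]; exact pow_le_pow_left₀ (abs_nonneg _) hc5 2
    have hεε : ε ^ 2 ≤ ε := by
      calc ε ^ 2 = ε * ε := sq ε
        _ ≤ ε * 1 := mul_le_mul_of_nonneg_left hε1 hε.le
        _ = ε := mul_one ε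
    have h50 : 50 * (1 / K ^ 100) ≤ 1 / K ^ 20 := by
      rw [mul_one_div, div_le_div_iff₀ (by positivity) (by positivity), one_mul]
      have h80 : (50 : ℝ) ≤ K ^ 80 := by
        have : (16 : ℝ) ^ 80 ≤ K ^ 80 := pow_le_pow_left₀ (by norm_num) hK 80
        linarith
      calc (50 : ℝ) * K ^ 20 ≤ K ^ 80 * K ^ 20 := mul_le_mul_of_nonneg_right h80 (by positivity)
        _ = K ^ 100 := by ring
    have : (5 * ε) ^ 2 = 25 * ε ^ 2 := by ring
    linarith [hεε.trans hε100]
  have hleT : ∀ s, τ + δ + K⁻¹ + L ≤ s → s ≤ T →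
      X s 0 ^ 2 + X s 1 ^ 2 + X s 2 ^ 2 + X s 3 ^ 2 ≤ 143 / K ^ 20 := by
    intro s hs1 hs2
    have had :=
      ad_small_on hX h0 hε hε1 hρ hρε hM0 hMK hK hεK hMρ hε100 hKM hδ hon hL hN4 hτ1 hfit hT2 hρT
      hcτ hcτeq ⟨hs1, hs2⟩
    have hs0 : 0 ≤ s := by linarith
    have := hbc s ⟨hs0, hs2.trans hT2⟩
    have : 142 / K ^ 20 + 1 / K ^ 20 = 143 / K ^ 20 := by ring
    linarith
  by_cases h2 : t ≤ T
  · exact hleT t ht h2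
  · -- `t > T`: monotonicity of `ã` from time `T`
    have h2' : T < t := not_le.1 h2
    have hST := hleT T hfit le_rfl
    have hsumT := traj_sum_sq_eq_one hX h0 T
    have hsumt := traj_sum_sq_eq_one hX h0 t
    have hmonoE := rotorCircuit_output_monotone hK0.le hX
    have heTt : X T 4 ≤ X t 4 := hmonoE h2'.le
    have heT0 : 0 ≤ X T 4 := e_nonneg hX h0 hK0.le (by linarith)
    have hsq : X T 4 ^ 2 ≤ X t 4 ^ 2 := pow_le_pow_left₀ heT0 heTt 2
    linarith

end PulseBeable

end Summit.NavierStokesRegularity.FluidComputer.RotorKnob
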